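import Summits.ResolutionOfSingularities.ResolutionOfSingularities.Theorems.EquisingularLiftEquisingularLiftNatClusterStepDefs
import HarnessLib

/-!
# Route `EquisingularLift`, crux EL♮ (stmt-ResolutionOfSingularities-20038) / EL♮(3) (stmt-…-20148) — named DOWNSTAIRS predicates of the lead's
# skeleton, rung TOWER («Lipman shadow»): step constructors `TowerPtReg` / `TowerPtRam` / `TowerRound` (+ `TowerFull`, `ConeWitness`), the
# in-carrier closure with cone shadow `InCarrierReachK`, and the sub-chain predicate `ReachTower` for K5′'s slot `Reach`

res-L1-w45b-lead-2 g2 (lead), typing PLANNER-MEMO-g11-1 §2 (res-L1-w45b-plan-1 g11; after res-L1-w45b-idea-1's cards `positive-towers` /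
`lipman-clock` / `cone-shadow` (SLOT-T-K) and res-L1-w45b-tri-1 and -tri-2 triage round 7) WITH the amendment of LEAD-MEMO-7 §3 (`DirStepUnobs ∨ ConeWitness`);
draft `L/res-L1-w45b-lead-2/TOWERSTEP-draft-v0.lean` b94a8bd8f97ce063 (STATUS 2026-08-27T14:56:20Z, no objection). OURS; planning vocabulary of the
crux chain, not a statement of any manuscript; AI-written, weaker than expert review. The registered rung stub `stub_elnat_towerPointResolution` =
K5′'s downstairs hypothesis (res-D-pv-029 `target_elnat_of_subchainResolution'`, p523491) at `Reach := ReachTower` ⇒ horizontal EL♮; conditional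
instance = one application of K5′ (…NatTowerPointResolutionOfSubchainLift); upstairs debt HSUB′(ReachTower) = PLANNER-MEMO-g11-1 §3 (sections ✓,
multisections via T-MULTISEC p509091/p510326 + «K5-FAT» Member clause (i♯), Čech-witnessed rounds via T-P1VB (res-type-027), cone-witnessed rounds via
T-CARRIER-Δ p519891 + «strict transform along a Cartier divisor is an iso» (Literature `IsBlowup.isIso`)). The Lipman CLOCK (termination, premise
`Lipman1978NoEternalNormalisedBranch`) is NOT part of the registered rung (route-level object; LEAD-MEMO-7 §2 (b)).
Every predicate is DOWNSTAIRS-ONLY. Progress clauses (reduction / non-principal trace) are DELIBERATELY OMITTED: they serve the clock (T-b), not the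
registered implication (T-a) «∃ resolving ReachTower-chain ⇒ horizontal EL♮», which only needs every admitted step to be LIFTABLE.

Stage predicate over the seed stage `F₁₀` (after the carrier-curve blow-up `υ' : F₁₀ ⟶ F₉`): `R₁ G γ T E K` — ambient `G` with `γ : G ⟶ F₁₀`, running
strict transform `T`, running exceptional surface `E`, running CONE SHADOW `K` (the strict transform of the TC⁺ carrier surface `W`, carried along from the
point step so that cone-witnessed rounds can be stated downstairs; the in-carrier point closure `InCarrierReachK` is rung v7's inner closure with `K` added).
* `TowerPtReg`  — reduced point step at a point of `T̃` where the AMBIENT stage is regular (= rung v7's in-carrier point step; upstairs: a section).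
* `TowerPtRam`  — CURVILINEAR FAT POINT step at a point of `T̃` where the ambient stage is NOT regular: blow up `J` with `supp J = {y}`, `J_y = (ℓ₁, ℓ₂, ℓ₃)`,
  `ℓᵢ ∈ 𝔪_{G,y}` cotangent-independent (upstairs: the ramified multisection `V(ℓ̃₁, ℓ̃₂, ℓ̃₃) = Spec O′`, T-MULTISEC / PLANNER-MEMO-g11-1 §3; engine gap K5-FAT).
* `ConeWitness` — «`Z = E ∩ K` with reduced scheme-theoretic intersection» (upstairs: `St(𝒦) ∩ E_C`, a Cartier cut of the regular 3-fold `St 𝒦`, 𝒦 the Δ-lift of `W`;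
  T-CARRIER-Δ p519891 at level 1, «strict transform along a Cartier divisor is an iso» above — NO H¹; idea-1 SLOT-T-K K1–K3).
* `TowerRound`  — blow-up of a closed `Z ⊆ E ∩ T` which is a FULL (MULTI)SECTION over the carrier curve `Z₉` (finite, flat, surjective on reduced structures),
  admitted when EITHER (`G` and `Ẽ` regular along `Z` ∧ `DirStepUnobs`) OR `ConeWitness`.
* `ReachTower`  — rung v7's `W`-clauses, `InCarrierReachK` to `(F₉, β₉, T₉, Z₉, K₉, b₉)`, the carrier-curve blow-up, then the closure of the seed
  `(F₁₀, 𝟙, closure υ'⁻¹(T₉ ∖ Z₉), υ'⁻¹ Z₉, closure υ'⁻¹(K₉ ∖ Z₉))` under the three constructors, ending `(F', γ', T', E', K')`, `β = (γ' ≫ υ') ≫ β₉`.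
Sanity: no (pt-ram), only Čech-witnessed section rounds, `K` ignored = `ReachDirZero`'s chains (up to the extra `K`-bookkeeping).
-/

set_option linter.dupNamespace false

noncomputable section

open CategoryTheory AlgebraicGeometry TopologicalSpace
open Literature.AlgebraicGeometry.Resolution (IsBlowup stalkIdeal)

namespace Summit.ResolutionOfSingularities.ResolutionOfSingularities.Cruxes.EquisingularLiftNat.Sections

/-- The point of `G` under a point of the reduced running curve `V(closure Z)_red`. -/
abbrev curvePt (G : Scheme.{0}) (Z : Set G) (y : redSub G (closure Z) isClosed_closure) : G :=
  redSubι G (closure Z) isClosed_closure y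

/-- **TOWER / in-carrier point closure carrying the cone shadow** — rung v7's inner closure (regular points of the running carrier curve anywhere;
one non-regular point while the flag is down) with a fifth component `K ↦ closure υ₁⁻¹(K ∖ {y})`. Downstairs only. -/
def InCarrierReachK (F₂ : Scheme.{0}) (T₂ Z₂ K₂ : Set F₂) (F₉ : Scheme.{0}) (β₉ : F₉ ⟶ F₂) (T₉ Z₉ K₉ : Set F₉) (b₉ : Bool) : Prop :=
  ∀ R : (∀ G : Scheme.{0}, (G ⟶ F₂) → Set G → Set G → Set G → Bool → Prop),
    R F₂ (𝟙 F₂) T₂ Z₂ K₂ false →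
    (∀ (G₁ G₂ : Scheme.{0}) (β : G₁ ⟶ F₂) (T Z K : Set G₁) (b : Bool) (y : redSub G₁ (closure Z) isClosed_closure) (υ₁ : G₂ ⟶ G₁)
        (hy : IsClosed ({curvePt G₁ Z y} : Set G₁)),
      R G₁ β T Z K b → curvePt G₁ Z y ∈ T →
      IsRegularLocalRing ((redSub G₁ (closure Z) isClosed_closure).presheaf.stalk y) →
      IsRegularLocalRing (G₁.presheaf.stalk (curvePt G₁ Z y)) →
      IsBlowup υ₁ (Scheme.IdealSheafData.vanishingIdeal (⟨{curvePt G₁ Z y}, hy⟩ : Closeds G₁)) →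
      R G₂ (υ₁ ≫ β) (closure (υ₁ ⁻¹' (T \ {curvePt G₁ Z y}))) (closure (υ₁ ⁻¹' (Z \ {curvePt G₁ Z y})))
        (closure (υ₁ ⁻¹' (K \ {curvePt G₁ Z y}))) b) →
    (∀ (G₁ G₂ : Scheme.{0}) (β : G₁ ⟶ F₂) (T Z K : Set G₁) (y : redSub G₁ (closure Z) isClosed_closure) (υ₁ : G₂ ⟶ G₁)
        (hy : IsClosed ({curvePt G₁ Z y} : Set G₁)),
      R G₁ β T Z K false → curvePt G₁ Z y ∈ T →
      ¬ IsRegularLocalRing ((redSub G₁ (closure Z) isClosed_closure).presheaf.stalk y) →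
      IsRegularLocalRing (G₁.presheaf.stalk (curvePt G₁ Z y)) →
      IsBlowup υ₁ (Scheme.IdealSheafData.vanishingIdeal (⟨{curvePt G₁ Z y}, hy⟩ : Closeds G₁)) →
      R G₂ (υ₁ ≫ β) (closure (υ₁ ⁻¹' (T \ {curvePt G₁ Z y}))) (closure (υ₁ ⁻¹' (Z \ {curvePt G₁ Z y})))
        (closure (υ₁ ⁻¹' (K \ {curvePt G₁ Z y}))) true) →
    R F₉ β₉ T₉ Z₉ K₉ b₉

/-- **TOWER / (pt-reg)** — reduced point step at a closed point `y` of the reduced running strict transform `T̃ = V(closure T)_red` where `T̃` is NOT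
regular and the AMBIENT stage `G` IS regular (upstairs: an `O`-section, as in rung v7). New stage: `T ↦ closure υ₂⁻¹(T ∖ {y})`, `K ↦ closure υ₂⁻¹(K ∖ {y})`,
and `E ↦ υ₂⁻¹{y}` (the new exceptional plane) as well as `E ↦ closure υ₂⁻¹(E ∖ {y})`. Downstairs only. -/
def TowerPtReg (F₁₀ : Scheme.{0}) (R₁ : ∀ G : Scheme.{0}, (G ⟶ F₁₀) → Set G → Set G → Set G → Prop) : Prop :=
  ∀ (G G' : Scheme.{0}) (γ : G ⟶ F₁₀) (T E K : Set G) (y : redSub G (closure T) isClosed_closure) (υ₂ : G' ⟶ G)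
      (hy : IsClosed ({curvePt G T y} : Set G)),
    R₁ G γ T E K →
    ¬ IsRegularLocalRing ((redSub G (closure T) isClosed_closure).presheaf.stalk y) →
    IsRegularLocalRing (G.presheaf.stalk (curvePt G T y)) →
    IsBlowup υ₂ (Scheme.IdealSheafData.vanishingIdeal (⟨{curvePt G T y}, hy⟩ : Closeds G)) →
    R₁ G' (υ₂ ≫ γ) (closure (υ₂ ⁻¹' (T \ {curvePt G T y}))) (υ₂ ⁻¹' {curvePt G T y}) (closure (υ₂ ⁻¹' (K \ {curvePt G T y}))) ∧
      R₁ G' (υ₂ ≫ γ) (closure (υ₂ ⁻¹' (T \ {curvePt G T y}))) (closure (υ₂ ⁻¹' (E \ {curvePt G T y})))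
        (closure (υ₂ ⁻¹' (K \ {curvePt G T y})))

/-- **TOWER / (pt-ram)** — CURVILINEAR FAT POINT step (PLANNER-MEMO-g11-1 §2, R-PT♮) at a closed point `y` of `T̃` where NEITHER `T̃` NOR the ambient
stage `G` is regular (no `O`-section passes: `ϖ ∈ 𝔪²`): the centre is an ideal sheaf `J` supported at `y` whose stalk is generated by three elements of
`𝔪_{G,y}` with LINEARLY INDEPENDENT classes in the cotangent space `𝔪/𝔪²` (upstairs: the regular multisection `V(ℓ̃₁, ℓ̃₂, ℓ̃₃) = Spec O′`, finite flat
over `O`, special fibre `V(J)` — engine gap K5-FAT: `Member` clause (i♯) with the non-radical `J`). Progress clause (`J·𝒪_{T̃,y}` a reduction of `𝔪`)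
omitted (clock-side). New stage as in (pt-reg) with `IsBlowup υ₂ J`. Downstairs only. -/
def TowerPtRam (F₁₀ : Scheme.{0}) (R₁ : ∀ G : Scheme.{0}, (G ⟶ F₁₀) → Set G → Set G → Set G → Prop) : Prop :=
  ∀ (G G' : Scheme.{0}) (γ : G ⟶ F₁₀) (T E K : Set G) (y : redSub G (closure T) isClosed_closure) (J : G.IdealSheafData)
      (υ₂ : G' ⟶ G),
    R₁ G γ T E K →
    ¬ IsRegularLocalRing ((redSub G (closure T) isClosed_closure).presheaf.stalk y) →
    ¬ IsRegularLocalRing (G.presheaf.stalk (curvePt G T y)) →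
    (J.support : Set G) = {curvePt G T y} →
    (∃ (ℓ : Fin 3 → G.presheaf.stalk (curvePt G T y)) (hℓ : ∀ i, ℓ i ∈ IsLocalRing.maximalIdeal (G.presheaf.stalk (curvePt G T y))),
      stalkIdeal J (curvePt G T y) = Ideal.span (Set.range ℓ) ∧
      LinearIndependent (IsLocalRing.ResidueField (G.presheaf.stalk (curvePt G T y)))
        (fun i => (IsLocalRing.maximalIdeal (G.presheaf.stalk (curvePt G T y))).toCotangent ⟨ℓ i, hℓ i⟩)) →
    IsBlowup υ₂ J →
    R₁ G' (υ₂ ≫ γ) (closure (υ₂ ⁻¹' (T \ {curvePt G T y}))) (υ₂ ⁻¹' {curvePt G T y}) (closure (υ₂ ⁻¹' (K \ {curvePt G T y}))) ∧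
      R₁ G' (υ₂ ≫ γ) (closure (υ₂ ⁻¹' (T \ {curvePt G T y}))) (closure (υ₂ ⁻¹' (E \ {curvePt G T y})))
        (closure (υ₂ ⁻¹' (K \ {curvePt G T y})))

/-- **TOWER / full (multi)section clause** — the reduced centre `Z̃` maps FINITELY, FLATLY and SURJECTIVELY onto the reduced carrier curve `Z̃₉`
under `G → F₁₀ → F₉` (m = 1 and an isomorphism is `DirStepSec`). Downstairs only. -/
def TowerFull (F₉ F₁₀ : Scheme.{0}) (υ' : F₁₀ ⟶ F₉) (Z₉ : Set F₉) (hZ₉ : IsClosed Z₉)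
    (G : Scheme.{0}) (γ : G ⟶ F₁₀) (Z : Set G) (hZ : IsClosed Z) : Prop :=
  ∃ δ : redSub G Z hZ ⟶ redSub F₉ Z₉ hZ₉, δ ≫ redSubι F₉ Z₉ hZ₉ = redSubι G Z hZ ≫ γ ≫ υ' ∧
    IsFinite δ ∧ Flat δ ∧ Function.Surjective δ

/-- **TOWER / cone witness** (LEAD-MEMO-7 §3, after idea-1's cone shadow): the centre IS the trace of the cone shadow on the exceptional surface —
`Z = E ∩ K` as sets and the scheme-theoretic intersection of the reduced structures is reduced (`𝓘(E) ⊔ 𝓘(K) = 𝓘(Z)`). Upstairs the centre is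
`St(𝒦) ∩ E_C` for the Δ-lift `𝒦` of the carrier surface `W` — a Cartier cut of a regular 3-fold: no unobstructedness datum needed. Downstairs only. -/
def ConeWitness (G : Scheme.{0}) (E : Set G) (hE : IsClosed E) (K : Set G) (Z : Set G) (hZ : IsClosed Z) : Prop :=
  Z = E ∩ closure K ∧
    Scheme.IdealSheafData.vanishingIdeal (⟨E, hE⟩ : Closeds G) ⊔
        Scheme.IdealSheafData.vanishingIdeal (⟨closure K, isClosed_closure⟩ : Closeds G) =
      Scheme.IdealSheafData.vanishingIdeal (⟨Z, hZ⟩ : Closeds G)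

/-- **TOWER / (round-full)** — blow up a closed `Z ⊆ E ∩ T`, a FULL (MULTI)SECTION over the carrier curve (`TowerFull`), admitted when EITHER the
ambient and the reduced surface `Ẽ` are regular along `Z` and the embedded deformations of `Z̃` in `Ẽ` are unobstructed (`DirStepUnobs`, the DIR₀
certificate) OR `Z` is cone-witnessed (`ConeWitness`). New stage: `T ↦ closure υ₂⁻¹(T ∖ Z)`, `K ↦ closure υ₂⁻¹(K ∖ Z)`, `E ↦ υ₂⁻¹ Z` as well as
`E ↦ closure υ₂⁻¹(E ∖ Z)`. Downstairs only. -/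
def TowerRound (F₉ F₁₀ : Scheme.{0}) (υ' : F₁₀ ⟶ F₉) (Z₉ : Set F₉) (hZ₉ : IsClosed Z₉)
    (R₁ : ∀ G : Scheme.{0}, (G ⟶ F₁₀) → Set G → Set G → Set G → Prop) : Prop :=
  ∀ (G G' : Scheme.{0}) (γ : G ⟶ F₁₀) (T E K : Set G) (hE : IsClosed E) (Z : Set G) (hZ : IsClosed Z) (υ₂ : G' ⟶ G),
    R₁ G γ T E K →
    Z ⊆ E ∩ T → Z.Nonempty →
    TowerFull F₉ F₁₀ υ' Z₉ hZ₉ G γ Z hZ →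
    ((∀ x : redSub G Z hZ, IsRegularLocalRing (G.presheaf.stalk (redSubι G Z hZ x))) ∧
        (∀ (i : redSub G Z hZ ⟶ redSub G E hE), i ≫ redSubι G E hE = redSubι G Z hZ →
          ∀ x : redSub G Z hZ, IsRegularLocalRing ((redSub G E hE).presheaf.stalk (i x))) ∧
        DirStepUnobs G E hE Z hZ ∨
      ConeWitness G E hE K Z hZ) →
    IsBlowup υ₂ (Scheme.IdealSheafData.vanishingIdeal (⟨Z, hZ⟩ : Closeds G)) →
    R₁ G' (υ₂ ≫ γ) (closure (υ₂ ⁻¹' (T \ Z))) (υ₂ ⁻¹' Z) (closure (υ₂ ⁻¹' (K \ Z))) ∧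
      R₁ G' (υ₂ ≫ γ) (closure (υ₂ ⁻¹' (T \ Z))) (closure (υ₂ ⁻¹' (E \ Z))) (closure (υ₂ ⁻¹' (K \ Z)))

/-- **ReachTower** — the admissible downstairs sub-chain predicate of rung TOWER for K5′'s slot `Reach` (module docstring): rung v7's `W`-clauses
at `x`, the in-carrier point closure with cone shadow `K₂ := St W = closure υ⁻¹(W ∖ {x})`, the carrier-curve blow-up `υ'`, then the closure of the
seed under {`TowerPtReg`, `TowerPtRam`, `TowerRound`}; `β = (γ' ≫ υ') ≫ β₉`. Downstairs only. -/
def ReachTower (F₁ F₂ : Scheme.{0}) (υ : F₂ ⟶ F₁) (x : F₁) (T₂ : Set F₂) (F' : Scheme.{0}) (β : F' ⟶ F₂) (T' : Set F') : Prop :=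
  ∃ (W : Set F₁) (F₉ : Scheme.{0}) (β₉ : F₉ ⟶ F₂) (T₉ Z₉ K₉ : Set F₉) (b₉ : Bool) (hZ₉ : IsClosed Z₉)
    (F₁₀ : Scheme.{0}) (υ' : F₁₀ ⟶ F₉) (γ' : F' ⟶ F₁₀) (E' K' : Set F'),
    x ∈ W ∧ ¬ (υ ⁻¹' {x} ⊆ closure (υ ⁻¹' (W \ {x}))) ∧
    (∃ U : F₁.affineOpens, x ∈ (U : F₁.Opens) ∧
      ((Scheme.IdealSheafData.vanishingIdeal (⟨closure W, isClosed_closure⟩ : Closeds F₁)).ideal U).IsPrincipal) ∧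
    υ ⁻¹' {x} ∩ closure (υ ⁻¹' (W \ {x})) ⊆ T₂ ∧
    InCarrierReachK F₂ T₂ (υ ⁻¹' {x} ∩ closure (υ ⁻¹' (W \ {x}))) (closure (υ ⁻¹' (W \ {x}))) F₉ β₉ T₉ Z₉ K₉ b₉ ∧
    Z₉ ⊆ T₉ ∧ ¬ (T₉ ⊆ Z₉) ∧
    Set.Finite {z : redSub F₉ Z₉ hZ₉ | ¬ IsRegularLocalRing ((redSub F₉ Z₉ hZ₉).presheaf.stalk z)} ∧
    IsBlowup υ' (Scheme.IdealSheafData.vanishingIdeal (⟨Z₉, hZ₉⟩ : Closeds F₉)) ∧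
    (∀ R₁ : (∀ G : Scheme.{0}, (G ⟶ F₁₀) → Set G → Set G → Set G → Prop),
      R₁ F₁₀ (𝟙 F₁₀) (closure (υ' ⁻¹' (T₉ \ Z₉))) (υ' ⁻¹' Z₉) (closure (υ' ⁻¹' (K₉ \ Z₉))) →
      TowerPtReg F₁₀ R₁ → TowerPtRam F₁₀ R₁ → TowerRound F₉ F₁₀ υ' Z₉ hZ₉ R₁ → R₁ F' γ' T' E' K') ∧
    β = (γ' ≫ υ') ≫ β₉

end Summit.ResolutionOfSingularities.ResolutionOfSingularities.Cruxes.EquisingularLiftNat.Sections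

end
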